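import Literature.Analysis.FluidPDE.CompressibleEulerImplosionSonicAnalytic
import HarnessLib

/-!
# Buckmaster–Cao-Labora–Gómez-Serrano at `γ = 5/3`: the analytic branch crosses the sonic line transversally

Topic `Literature/Analysis/FluidPDE`; namespace
`Literature.Analysis.FluidPDE.BuckmasterCaolaboraGomezserrano2025.Monatomic.SonicSeries`. Companion
of `CompressibleEulerImplosion.lean` (named fact `BuckmasterCaolaboraGomezserrano2025_thm11_monatomic`,
THEOREM 1.1 of T. Buckmaster, G. Cao-Labora, J. Gómez-Serrano, *Smooth imploding solutions for 3D
compressible fluids*, Forum Math. Pi 13 (2025) e6, arXiv:2208.09445, at `γ = 5/3`, `α = 1/3`);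
sequel of `CompressibleEulerImplosionSonicAnalytic.lean` (the analytic branch `(W^{(r)}, Z^{(r)})`
through `P_s`).

Brick C3 of the discharge plan: along the analytic branch through `P_s`, `r ∈ (r₃, r₄)`,
`(d/dξ) D_Z(W^{(r)}, Z^{(r)})(0) = D_{Z,1} = 2 − r − ℛ₂/4 > 0` (Lemma 2.1 / Lemma 9.11), hence for
some `δ₀ > 0` the branch is off both sonic lines with `D_Z < 0 < D_W`, `Z < W` for branch times
in `[−δ₀, 0)` (the side of `P₀`, used by the shooting argument of §6) and with `D_Z > 0`,
`D_W > 0`, `Z < W` for branch times in `(0, δ₀]` (the side of `P_∞`, the starting point of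
Proposition 3.1: "the solution stays in the region where `D_W > 0`, `D_Z > 0`").
(`hasDerivAt_DZ_branch_zero`, `branch_signs`.) Theorems only.
[cite: BuckmasterCaolaboraGomezserrano2025, Prop. 2.3, Lemma 2.1, Lemma 9.11, Prop. 3.1, §6]
-/

noncomputable section

open Set Filter Topology

namespace Literature.Analysis.FluidPDE

namespace BuckmasterCaolaboraGomezserrano2025

namespace Monatomic

namespace SonicSeries

variable {r : ℝ}

/-- `D_Z` along the branch has derivative `D_{Z,1} = (W₁ + 2Z₁)/3 = 2 − r − p` at `ξ = 0`.
[cite: BuckmasterCaolaboraGomezserrano2025, Lemma 2.1, Lemma 9.11] -/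
theorem hasDerivAt_DZ_branch_zero (h3 : r3 < r) (h4 : r < r4) :
    HasDerivAt (fun t => DZ (Wloc r t) (Zloc r t)) (2 - r - p r) 0 := by
  obtain ⟨_, _, hW1, hZ1, hspec⟩ := sonicSeries_spec' h3 h4
  have hρ : |(0 : ℝ)| < sonicRad r := by
    rw [abs_zero]; exact sonicRad_pos (h4.trans r3_r4_mem.2.2)
  obtain ⟨hanW, hanZ, _, _⟩ := hspec 0 hρ
  have hW : HasDerivAt (Wloc r) (W1 r) 0 := by
    rw [← hW1]; exact hanW.differentiableAt.hasDerivAt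
  have hZ : HasDerivAt (Zloc r) (Z1 r) 0 := by
    rw [← hZ1]; exact hanZ.differentiableAt.hasDerivAt
  have h := ((hW.add (hZ.const_mul 2)).div_const 3).const_add 1
  have e : (fun t => DZ (Wloc r t) (Zloc r t)) = fun t => 1 + (Wloc r t + 2 * Zloc r t) / 3 := by
    funext t; unfold DZ; ring
  rw [e]
  refine h.congr_deriv ?_
  rw [← DZ1_eq]; ring

/-- **Transversal crossing of the sonic line.** For `r ∈ (r₃, r₄)` there is `δ₀ > 0` (with
`δ₀ < sonicRad r`) such that along the analytic branch: for branch times `t ∈ [−δ₀, 0)`,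
`D_Z < 0 < D_W` and `Z < W`; for `t ∈ (0, δ₀]`, `0 < D_Z`, `0 < D_W` and `Z < W`.
[cite: BuckmasterCaolaboraGomezserrano2025, Prop. 2.3, Prop. 3.1, §6] -/
theorem branch_signs (h3 : r3 < r) (h4 : r < r4) :
    ∃ δ₀ > (0 : ℝ), δ₀ < sonicRad r ∧
      (∀ t ∈ Ico (-δ₀) 0,
        0 < DW (Wloc r t) (Zloc r t) ∧ DZ (Wloc r t) (Zloc r t) < 0 ∧ Zloc r t < Wloc r t) ∧
      (∀ t ∈ Ioc 0 δ₀,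
        0 < DW (Wloc r t) (Zloc r t) ∧ 0 < DZ (Wloc r t) (Zloc r t) ∧ Zloc r t < Wloc r t) := by
  have hm := r3_r4_mem
  have hr : r < rstar := h4.trans hm.2.2
  have hr2 : r < 2 := by linarith [rstar_lt]
  have hρ := sonicRad_pos hr
  obtain ⟨hW0, hZ0, _, _, hspec⟩ := sonicSeries_spec' h3 h4
  have hρ0 : |(0 : ℝ)| < sonicRad r := by rw [abs_zero]; exact hρ
  obtain ⟨hanW, hanZ, _, _⟩ := hspec 0 hρ0
  have hcW : ContinuousAt (Wloc r) 0 := hanW.continuousAt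
  have hcZ : ContinuousAt (Zloc r) 0 := hanZ.continuousAt
  -- `D_W > 0` and `Z < W` near `0` by continuity
  have hDWc : ContinuousAt (fun t => DW (Wloc r t) (Zloc r t)) 0 := by
    unfold DW; exact continuousAt_const.add (((continuousAt_const.mul hcW).add hcZ).div_const 3)
  have hDW0 : 0 < DW (Wloc r 0) (Zloc r 0) := by rw [hW0, hZ0]; exact DW_Ps_pos hr2
  have e1 : ∀ᶠ t in 𝓝 (0 : ℝ), 0 < DW (Wloc r t) (Zloc r t) := hDWc.eventually (lt_mem_nhds hDW0)
  have hgap0 : 0 < Wloc r 0 - Zloc r 0 := by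
    rw [hW0, hZ0]; unfold W0 Z0; linarith [q_nonneg r]
  have e2 : ∀ᶠ t in 𝓝 (0 : ℝ), 0 < Wloc r t - Zloc r t :=
    (hcW.sub hcZ).eventually (lt_mem_nhds hgap0)
  -- the sign of `D_Z` from its derivative `D_{Z,1} > 0` at `0` (value `0` there)
  have hD := hasDerivAt_DZ_branch_zero h3 h4
  have hD0 : DZ (Wloc r 0) (Zloc r 0) = 0 := by rw [hW0, hZ0]; exact DZ_Ps r
  have hpos : 0 < 2 - r - p r := DZ1_pos hr
  have hslope : Tendsto (slope (fun t => DZ (Wloc r t) (Zloc r t)) 0) (𝓝[≠] 0) (𝓝 (2 - r - p r)) :=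
    hasDerivAt_iff_tendsto_slope.mp hD
  have e3 : ∀ᶠ t in 𝓝[≠] (0 : ℝ), 0 < slope (fun t => DZ (Wloc r t) (Zloc r t)) 0 t :=
    (tendsto_order.1 hslope).1 0 hpos
  -- extract a radius
  have e3' : ∀ᶠ t in 𝓝 (0 : ℝ), t ≠ 0 → 0 < slope (fun t => DZ (Wloc r t) (Zloc r t)) 0 t :=
    eventually_nhdsWithin_iff.mp e3
  have e4 : ∀ᶠ t in 𝓝 (0 : ℝ), |t| < sonicRad r := by
    have : Iio (sonicRad r) ∈ 𝓝 (|(0 : ℝ)|) := by rw [abs_zero]; exact Iio_mem_nhds hρ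
    exact continuous_abs.continuousAt.preimage_mem_nhds this
  obtain ⟨ε, hε, hball⟩ := Metric.eventually_nhds_iff.mp (e1.and (e2.and (e3'.and e4)))
  refine ⟨ε / 2, by positivity, ?_, fun t ht => ?_, fun t ht => ?_⟩
  · have := (hball (y := ε / 2) (by rw [Real.dist_eq, sub_zero, abs_of_pos (by positivity)]; linarith)).2.2.2
    rwa [abs_of_pos (by positivity)] at this
  · have hd : dist t 0 < ε := by
      rw [Real.dist_eq, sub_zero, abs_lt]; constructor <;> linarith [ht.1, ht.2]
    obtain ⟨k1, k2, k3, _⟩ := hball hd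
    have ht0 : t ≠ 0 := ht.2.ne
    have hs := k3 ht0
    rw [slope_def_field, hD0, sub_zero, sub_zero] at hs
    refine ⟨k1, ?_, by linarith⟩
    -- `DZ t / t > 0` with `t < 0` gives `DZ t < 0`
    rcases lt_trichotomy (DZ (Wloc r t) (Zloc r t)) 0 with h | h | h
    · exact h
    · rw [h, zero_div] at hs; exact absurd hs (lt_irrefl 0)
    · exact absurd hs (not_lt.mpr (div_neg_of_pos_of_neg h ht.2).le)
  · have hd : dist t 0 < ε := by
      rw [Real.dist_eq, sub_zero, abs_lt]; constructor <;> linarith [ht.1, ht.2]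
    obtain ⟨k1, k2, k3, _⟩ := hball hd
    have ht0 : t ≠ 0 := ht.1.ne'
    have hs := k3 ht0
    rw [slope_def_field, hD0, sub_zero, sub_zero] at hs
    refine ⟨k1, ?_, by linarith⟩
    rcases lt_trichotomy (DZ (Wloc r t) (Zloc r t)) 0 with h | h | h
    · exact absurd hs (not_lt.mpr (div_neg_of_neg_of_pos h ht.1).le)
    · rw [h, zero_div] at hs; exact absurd hs (lt_irrefl 0)
    · exact h

end SonicSeries

end Monatomic

end BuckmasterCaolaboraGomezserrano2025

end Literature.Analysis.FluidPDE
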